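import Mathlib
import Summits.Ventures.PercRepro2.A3InactiveTyped
import Summits.Ventures.PercRepro2.CutVertexDefs
import Summits.Ventures.PercRepro2.PairHarris

/-!
# The position classes of typed Harris: definitions, the composition rule across a cut vertex
(blind cell PercRepro2, p5 g8, 2026-08-26; `proofs/P5-POSCLASS.md`, STATUS 01:43:10Z)

For a root `s` and the two copies `y` (red) and `y' = flipOn F y` (blue) of a profile, the **odd
statistic** of a vertex `x` is `f_x = 1_{x ∈ C_y(s)} − 1_{x ∈ C_{y'}(s)}` (`odd`).  Typed Harris
(`PairHarris.pairCount_harris`) says `N(f_u f_v) ≥ 0` (`stat_one_nonneg`).  Splitting by the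
position of a third vertex `w` — outside both clusters (`kOut`), red-only (`kRed`), blue-only
(`kBlue`), in both (`kCore`) — gives the four class statistics `stat F z ends s u v k`
(`stat_sum_classes`: they sum to `N(f_u f_v)`); the class `kOut` is the single-vertex typed BHK 1.3
`(TB13)_sv`, the class `kRed` the candidate (D) and `kRed + kCore` the candidate (B) of
`P5-POSCLASS.md` (census-true, not rows); `ClassTriple` names the five signs together.

**The composition rule across a cut vertex** (`kOut_across`, `kRed_across`, `kBlue_across`,
`kCore_across`, pointwise): if `x` is a cut vertex separating `w` from `s`, the class of `w` w.r.t.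
`s` is composed of the class of `x` w.r.t. `s` and the class of `w` w.r.t. `x` — the path lemma
`CutV.conn_across_iff` (`iL_across`: `1_{w ∈ C(s)} = 1_{x ∈ C(s)} · 1_{w ∈ C(x)}`).  The two-copy
counts of these rules (the transport of the class statistics and of the triple) are in
`PosClassCut.lean`.  Own work; standard axioms.
-/

namespace Summit.Ventures.PercRepro2

namespace PosClass

open CovForm A3InactiveTyped CutV

section Defs

variable {V : Type*} {E : Type*} {R : Type*} [Field R]

/-- The odd statistic `f_x = 1_{x ∈ C_y(s)} − 1_{x ∈ C_{y'}(s)}` of the two copies `y`, `y'`. -/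
noncomputable def odd (ends : E → Sym2 V) (s x : V) (y y' : Config E) : R :=
  iL ends s x y - iL ends s x y'

/-- Class «`w` outside both clusters of `s`». -/
noncomputable def kOut (ends : E → Sym2 V) (s w : V) (y y' : Config E) : R :=
  (1 - iL ends s w y) * (1 - iL ends s w y')

/-- Class «`w` in the red cluster only». -/
noncomputable def kRed (ends : E → Sym2 V) (s w : V) (y y' : Config E) : R :=
  iL ends s w y * (1 - iL ends s w y')

/-- Class «`w` in the blue cluster only». -/
noncomputable def kBlue (ends : E → Sym2 V) (s w : V) (y y' : Config E) : R :=
  (1 - iL ends s w y) * iL ends s w y'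

/-- Class «`w` in both clusters» (the core). -/
noncomputable def kCore (ends : E → Sym2 V) (s w : V) (y y' : Config E) : R :=
  iL ends s w y * iL ends s w y'

/-- `0 ≤ iL`. -/
lemma iL_nonneg [LinearOrder R] [IsStrictOrderedRing R] (ends : E → Sym2 V) (a v : V)
    (y : Config E) : 0 ≤ (iL ends a v y : R) := by
  unfold iL
  by_cases h : y ∈ connEvent ends a v <;> simp [h]

/-- `iL ≤ 1`. -/
lemma iL_le_one [LinearOrder R] [IsStrictOrderedRing R] (ends : E → Sym2 V) (a v : V)
    (y : Config E) : (iL ends a v y : R) ≤ 1 := by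
  unfold iL
  by_cases h : y ∈ connEvent ends a v <;> simp [h]

/-- `iL` through a connection equivalence. -/
lemma iL_eq_of_iff {ends : E → Sym2 V} {a v : V} {y : Config E} {ends' : E → Sym2 V} {a' v' : V}
    {y' : Config E} (h : Conn ends y a v ↔ Conn ends' y' a' v') :
    (iL ends a v y : R) = iL ends' a' v' y' := by
  unfold iL
  by_cases hc : Conn ends y a v
  · have hc' : Conn ends' y' a' v' := h.1 hc
    simp [mem_connEvent, hc, hc']
  · have hc' : ¬ Conn ends' y' a' v' := fun h' => hc (h.2 h')
    simp [mem_connEvent, hc, hc']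

/-- The product of the indicators of two connections is the indicator of their conjunction. -/
lemma iL_mul_iL_eq {ends : E → Sym2 V} {a v : V} {y : Config E} {ends₁ : E → Sym2 V} {a₁ v₁ : V}
    {y₁ : Config E} {ends₂ : E → Sym2 V} {a₂ v₂ : V} {y₂ : Config E}
    (h : Conn ends y a v ↔ Conn ends₁ y₁ a₁ v₁ ∧ Conn ends₂ y₂ a₂ v₂) :
    (iL ends a v y : R) = iL ends₁ a₁ v₁ y₁ * iL ends₂ a₂ v₂ y₂ := by
  unfold iL
  by_cases h₁ : Conn ends₁ y₁ a₁ v₁ <;> by_cases h₂ : Conn ends₂ y₂ a₂ v₂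
  · have hc : Conn ends y a v := h.2 ⟨h₁, h₂⟩
    simp [mem_connEvent, hc, h₁, h₂]
  · have hc : ¬ Conn ends y a v := fun hc => h₂ (h.1 hc).2
    simp [mem_connEvent, hc, h₁, h₂]
  · have hc : ¬ Conn ends y a v := fun hc => h₁ (h.1 hc).1
    simp [mem_connEvent, hc, h₁, h₂]
  · have hc : ¬ Conn ends y a v := fun hc => h₁ (h.1 hc).1
    simp [mem_connEvent, hc, h₁, h₂]

end Defs

section Stat

variable {V : Type*} {E : Type*} [Fintype E] [DecidableEq E] {R : Type*} [Field R]

/-- The class statistic `N(f_u · f_v · k)` at the profile `(F, z)`. -/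
noncomputable def stat (F : Finset E) (z : Config E) (ends : E → Sym2 V) (s u v : V)
    (k : Config E → Config E → R) : R :=
  pairCount F z (fun y y' => odd ends s u y y' * odd ends s v y y' * k y y')

/-- **Typed Harris for the odd statistics**: `0 ≤ N(f_u f_v)` at every profile. -/
theorem stat_one_nonneg [LinearOrder R] [IsStrictOrderedRing R] (F : Finset E) (z : Config E)
    (ends : E → Sym2 V) (s u v : V) :
    0 ≤ pairCount F z (fun y y' => odd ends s u y y' * odd ends s v y y' : Config E → Config E → R) := by
  have hexp : pairCount F z (fun y y' => odd ends s u y y' * odd ends s v y y' : Config E → Config E → R) =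
      pairCount F z (fun y y' => iL ends s u y * iL ends s v y : Config E → Config E → R) -
      pairCount F z (fun y y' => iL ends s u y * iL ends s v y' : Config E → Config E → R) -
      pairCount F z (fun y y' => iL ends s u y' * iL ends s v y : Config E → Config E → R) +
      pairCount F z (fun y y' => iL ends s u y' * iL ends s v y' : Config E → Config E → R) := by
    rw [← pairCount_sub, ← pairCount_sub, ← pairCount_add]
    unfold pairCount
    refine Finset.sum_congr rfl fun y _ => ?_
    split_ifs
    · unfold odd; ring
    · rfl
  have h1 : pairCount F z (fun y y' => iL ends s u y' * iL ends s v y' : Config E → Config E → R) =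
      pairCount F z (fun y y' => iL ends s u y * iL ends s v y : Config E → Config E → R) := by
    rw [pairCount_swap]
  have h2 : pairCount F z (fun y y' => iL ends s u y' * iL ends s v y : Config E → Config E → R) =
      pairCount F z (fun y y' => iL ends s u y * iL ends s v y' : Config E → Config E → R) := by
    rw [pairCount_swap]
  have hh := PairHarris.pairCount_harris_iL (R := R) ends s u v F z
  rw [hexp, h1, h2]
  linarith

end Stat

/-! ## Transport across a cut vertex -/

section Cut

variable {V : Type*} {E : Type*} {R : Type*} [Field R]
  {ends : E → Sym2 V} {x : V} {VA VB : Set V} {EA EB : Set E}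
  [DecidablePred (· ∈ EA)] [DecidablePred (· ∈ EB)]

omit [DecidablePred (· ∈ EB)] in
/-- On the `A`-side, `iL` only sees the `A`-edges. -/
lemma iL_restrictA (h : IsCut ends x VA VB EA EB) {a v : V} (ha : a ∈ VA ∪ {x})
    (hv : v ∈ VA ∪ {x}) (y : Config E) :
    (iL ends a v y : R) = iL ends a v (restrict EA y) :=
  iL_eq_of_iff (conn_iff_restrict h ha hv)

omit [DecidablePred (· ∈ EA)] in
/-- On the `B`-side, `iL` only sees the `B`-edges. -/
lemma iL_restrictB (h : IsCut ends x VA VB EA EB) {a v : V} (ha : a ∈ VB ∪ {x})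
    (hv : v ∈ VB ∪ {x}) (y : Config E) :
    (iL ends a v y : R) = iL ends a v (restrict EB y) :=
  iL_eq_of_iff (conn_iff_restrict h.symm ha hv)

omit [DecidablePred (· ∈ EB)] in
/-- The odd statistic of an `A`-side vertex only sees the `A`-edges. -/
lemma odd_restrictA (h : IsCut ends x VA VB EA EB) {s u : V} (hs : s ∈ VA ∪ {x})
    (hu : u ∈ VA ∪ {x}) (y y' : Config E) :
    (odd ends s u y y' : R) = odd ends s u (restrict EA y) (restrict EA y') := by
  unfold odd
  rw [iL_restrictA h hs hu y, iL_restrictA h hs hu y']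

/-- **Across the cut**: for `s` on the `A`-side (or `s = x`) and `w` on the `B`-side,
`1_{w ∈ C(s)} = 1_{x ∈ C(s)} · 1_{w ∈ C(x)}`. -/
lemma iL_across (h : IsCut ends x VA VB EA EB) {s w : V} (hs : s ∈ VA ∪ {x}) (hw : w ∈ VB)
    (y : Config E) : (iL ends s w y : R) = iL ends s x y * iL ends x w y := by
  rcases hs with hs | hs
  · refine iL_mul_iL_eq ?_
    rw [conn_across_iff h hs hw, ← conn_iff_restrict h (Or.inl hs) (Or.inr rfl),
      ← conn_iff_restrict h.symm (Or.inr rfl) (Or.inl hw)]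
  · rw [Set.mem_singleton_iff] at hs
    subst hs
    refine iL_mul_iL_eq ?_
    constructor
    · intro hc; exact ⟨conn_refl _ _ _, hc⟩
    · rintro ⟨_, hc⟩; exact hc

/-- A class kernel only sees the edges of a side on which `iL a b` does. -/
lemma kOut_restrict {S : Set E} [DecidablePred (· ∈ S)] {a b : V}
    (hab : ∀ y : Config E, (iL ends a b y : R) = iL ends a b (restrict S y)) (y y' : Config E) :
    (kOut ends a b y y' : R) = kOut ends a b (restrict S y) (restrict S y') := by
  unfold kOut; rw [hab y, hab y']

/-- A class kernel only sees the edges of a side on which `iL a b` does. -/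
lemma kRed_restrict {S : Set E} [DecidablePred (· ∈ S)] {a b : V}
    (hab : ∀ y : Config E, (iL ends a b y : R) = iL ends a b (restrict S y)) (y y' : Config E) :
    (kRed ends a b y y' : R) = kRed ends a b (restrict S y) (restrict S y') := by
  unfold kRed; rw [hab y, hab y']

/-- A class kernel only sees the edges of a side on which `iL a b` does. -/
lemma kBlue_restrict {S : Set E} [DecidablePred (· ∈ S)] {a b : V}
    (hab : ∀ y : Config E, (iL ends a b y : R) = iL ends a b (restrict S y)) (y y' : Config E) :
    (kBlue ends a b y y' : R) = kBlue ends a b (restrict S y) (restrict S y') := by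
  unfold kBlue; rw [hab y, hab y']

/-- A class kernel only sees the edges of a side on which `iL a b` does. -/
lemma kCore_restrict {S : Set E} [DecidablePred (· ∈ S)] {a b : V}
    (hab : ∀ y : Config E, (iL ends a b y : R) = iL ends a b (restrict S y)) (y y' : Config E) :
    (kCore ends a b y y' : R) = kCore ends a b (restrict S y) (restrict S y') := by
  unfold kCore; rw [hab y, hab y']

/-- **The composition rule of the classes across the cut** (pointwise): the class «`w` outside both
clusters of `s`» is composed of the classes of `x` (w.r.t. `s`) and of `w` (w.r.t. `x`). -/
lemma kOut_across (h : IsCut ends x VA VB EA EB) {s w : V} (hs : s ∈ VA ∪ {x}) (hw : w ∈ VB)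
    (y y' : Config E) :
    (kOut ends s w y y' : R) =
      kOut ends s x y y' * (kOut ends x w y y' + kRed ends x w y y' + kBlue ends x w y y' +
        kCore ends x w y y') +
      kRed ends s x y y' * (kOut ends x w y y' + kBlue ends x w y y') +
      kBlue ends s x y y' * (kOut ends x w y y' + kRed ends x w y y') +
      kCore ends s x y y' * kOut ends x w y y' := by
  unfold kOut kRed kBlue kCore
  rw [iL_across h hs hw y, iL_across h hs hw y']
  ring

/-- The composition rule for the class «`w` red-only». -/
lemma kRed_across (h : IsCut ends x VA VB EA EB) {s w : V} (hs : s ∈ VA ∪ {x}) (hw : w ∈ VB)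
    (y y' : Config E) :
    (kRed ends s w y y' : R) =
      kRed ends s x y y' * (kRed ends x w y y' + kCore ends x w y y') +
      kCore ends s x y y' * kRed ends x w y y' := by
  unfold kRed kCore
  rw [iL_across h hs hw y, iL_across h hs hw y']
  ring

/-- The composition rule for the class «`w` blue-only». -/
lemma kBlue_across (h : IsCut ends x VA VB EA EB) {s w : V} (hs : s ∈ VA ∪ {x}) (hw : w ∈ VB)
    (y y' : Config E) :
    (kBlue ends s w y y' : R) =
      kBlue ends s x y y' * (kBlue ends x w y y' + kCore ends x w y y') +
      kCore ends s x y y' * kBlue ends x w y y' := by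
  unfold kBlue kCore
  rw [iL_across h hs hw y, iL_across h hs hw y']
  ring

/-- The composition rule for the core class. -/
lemma kCore_across (h : IsCut ends x VA VB EA EB) {s w : V} (hs : s ∈ VA ∪ {x}) (hw : w ∈ VB)
    (y y' : Config E) :
    (kCore ends s w y y' : R) = kCore ends s x y y' * kCore ends x w y y' := by
  unfold kCore
  rw [iL_across h hs hw y, iL_across h hs hw y']
  ring

omit [DecidablePred (· ∈ EB)] in
/-- `iL s x` only sees the `A`-edges (for `s` on the `A`-side or `s = x`). -/
lemma iL_sx_restrictA (h : IsCut ends x VA VB EA EB) {s : V} (hs : s ∈ VA ∪ {x}) :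
    ∀ y : Config E, (iL ends s x y : R) = iL ends s x (restrict EA y) :=
  fun y => iL_restrictA h hs (Or.inr rfl) y

omit [DecidablePred (· ∈ EA)] in
/-- `iL x w` only sees the `B`-edges (for `w` on the `B`-side). -/
lemma iL_xw_restrictB (h : IsCut ends x VA VB EA EB) {w : V} (hw : w ∈ VB) :
    ∀ y : Config E, (iL ends x w y : R) = iL ends x w (restrict EB y) :=
  fun y => iL_restrictB h (Or.inr rfl) (Or.inl hw) y

end Cut

/-! ## Nonnegativity of the class counts and the class triple -/

section Triple

variable {V : Type*} {E : Type*} [Fintype E] [DecidableEq E] {R : Type*} [Field R]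
  [LinearOrder R] [IsStrictOrderedRing R]

omit [LinearOrder R] [IsStrictOrderedRing R] in
/-- The four classes of `x` partition the space: `out + red + blue + core = 1` pointwise. -/
lemma stat_sum_classes (F : Finset E) (z : Config E) (ends : E → Sym2 V) (s u v x : V) :
    stat F z ends s u v (kOut ends s x) + stat F z ends s u v (kRed ends s x) +
      stat F z ends s u v (kBlue ends s x) + stat F z ends s u v (kCore ends s x) =
      pairCount F z (fun y y' => odd ends s u y y' * odd ends s v y y' : Config E → Config E → R) := by
  unfold stat
  rw [← pairCount_add, ← pairCount_add, ← pairCount_add]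
  unfold pairCount
  refine Finset.sum_congr rfl fun y _ => ?_
  split_ifs
  · simp only [kOut, kRed, kBlue, kCore]
    ring
  · rfl

omit [Fintype E] [DecidableEq E] in
/-- The class kernels are pointwise nonnegative. -/
lemma kOut_nonneg (ends : E → Sym2 V) (a b : V) (y y' : Config E) : 0 ≤ (kOut ends a b y y' : R) :=
  mul_nonneg (sub_nonneg.2 (iL_le_one ends a b y)) (sub_nonneg.2 (iL_le_one ends a b y'))

omit [Fintype E] [DecidableEq E] in
/-- The class kernels are pointwise nonnegative. -/
lemma kRed_nonneg (ends : E → Sym2 V) (a b : V) (y y' : Config E) : 0 ≤ (kRed ends a b y y' : R) :=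
  mul_nonneg (iL_nonneg ends a b y) (sub_nonneg.2 (iL_le_one ends a b y'))

omit [Fintype E] [DecidableEq E] in
/-- The class kernels are pointwise nonnegative. -/
lemma kBlue_nonneg (ends : E → Sym2 V) (a b : V) (y y' : Config E) :
    0 ≤ (kBlue ends a b y y' : R) :=
  mul_nonneg (sub_nonneg.2 (iL_le_one ends a b y)) (iL_nonneg ends a b y')

omit [Fintype E] [DecidableEq E] in
/-- The class kernels are pointwise nonnegative. -/
lemma kCore_nonneg (ends : E → Sym2 V) (a b : V) (y y' : Config E) :
    0 ≤ (kCore ends a b y y' : R) :=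
  mul_nonneg (iL_nonneg ends a b y) (iL_nonneg ends a b y')

/-- A two-copy count of a pointwise nonnegative kernel is nonnegative. -/
lemma pairCount_nonneg' (F : Finset E) (z : Config E) (Φ : Config E → Config E → R)
    (hΦ : ∀ y w, 0 ≤ Φ y w) : 0 ≤ pairCount F z Φ := by
  unfold pairCount
  refine Finset.sum_nonneg fun y _ => ?_
  split_ifs
  · exact hΦ _ _
  · exact le_rfl

/-- **The class triple** at a profile: (TB13) `0 ≤ out`, (D) `0 ≤ red`, `0 ≤ blue`, and (B)
`0 ≤ red + core`, `0 ≤ blue + core` — the inductive family of the cut-vertex transport. -/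
def ClassTriple (F : Finset E) (z : Config E) (ends : E → Sym2 V) (s u v w : V) : Prop :=
  0 ≤ (stat F z ends s u v (kOut ends s w) : R) ∧
  0 ≤ (stat F z ends s u v (kRed ends s w) : R) ∧
  0 ≤ (stat F z ends s u v (kBlue ends s w) : R) ∧
  0 ≤ (stat F z ends s u v (kRed ends s w) : R) + stat F z ends s u v (kCore ends s w) ∧
  0 ≤ (stat F z ends s u v (kBlue ends s w) : R) + stat F z ends s u v (kCore ends s w)

end Triple

end PosClass

end Summit.Ventures.PercRepro2
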